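import Summits.Ventures.PercRepro.RankLevelSet

/-!
# PercRepro — C-025 «RANK LEVEL-SET INEQUALITY»: Theorem G′, no circuit of size ≤ q + 1 (p3, gen 6)

`C025` (typer-2 `RankLevelSet.lean`): `Φ(p,q)·|U(p,q)| ≤ |Y(p,q)|` with `U(p,q) = {A ⊆ E : r(A) = p, r(E ∖ A) = q}`,
`Y(p,q) = {A ⊆ E : q < r(A) < p}`, `Φ = phiK`. Mine-2's Theorem G′ (`proofs/MINE2-RLS.md` §7): if every circuit
has at least `q + 2` elements — equivalently every subset of `E` with `≤ q + 1` elements is independent (for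
`q = 1`: `M` simple; paving and sparse paving matroids, Vámos, …) — then the row holds for `(p, q)`.

* `small_indep_of_circuits` — the circuit form of the hypothesis gives the independence form;
* `succ_le_eRk_of_small_indep` — a subset of `E` with `≥ q + 1` elements has rank `≥ q + 1`;
* `ncard_eq_of_eRk_eq_of_small_indep` — a subset of `E` of rank `q` has exactly `q` elements;
* `ncard_U_le_choose_of_small_indep` — `|U(p,q)| ≤ C(|E|, q)` (`A ↦ E ∖ A` into the `q`-subsets of `E`);
* `sum_choose_le_ncard_Y_of_small_indep` — `Σ_{q<u<p} C(|E|, u) ≤ |Y(p,q)|` (every subset with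
  `q < |S| < p` has `q < r(S) < p`);
* `choose_mul_choose_le_of_le` — `C(n,u)·C(c,q) ≤ C(c,u)·C(n,q)` for `q ≤ u ≤ n ≤ c` (the ratio
  `C(c,u)/C(c,q)` is non-decreasing in `c`; induction on `c` through `Nat.choose_mul_succ_eq`);
* **`c025_of_small_indep`**, **`c025_of_circuits`** — Theorem G′ in both forms, every `p` (for
  `p ≤ q + 1` the left side is `0`); the set-builders are byte-identical to the body of `C025`.
  Proof: `U(p,q) ≠ ∅` gives `|E| ≥ p + q`; then `Φ(p,q)·C(|E|,q) ≤ Σ_{q<u<p} C(|E|,u)` by the ratio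
  monotonicity with `C(p+q,p) = C(p+q,q)`.
Axioms: standard.
-/

namespace PercRepro

open Set Matroid

variable {α : Type} {M : Matroid α}

/-- «Every circuit has at least `q + 2` elements» gives «every subset of `E` with at most `q + 1` elements
is independent». -/
lemma small_indep_of_circuits {q : ℕ} (hcirc : ∀ C, M.IsCircuit C → ((q + 2 : ℕ) : ℕ∞) ≤ C.encard) :
    ∀ T ⊆ M.E, T.encard ≤ q + 1 → M.Indep T := by
  intro T hT hTcard
  by_contra hdep
  rw [not_indep_iff hT] at hdep
  obtain ⟨C, hCT, hC⟩ := hdep.exists_isCircuit_subset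
  have h1 := hcirc C hC
  have h2 : C.encard ≤ (q : ℕ∞) + 1 := (encard_le_encard hCT).trans hTcard
  have h3 : ((q + 2 : ℕ) : ℕ∞) ≤ (q : ℕ∞) + 1 := h1.trans h2
  have h4 : q + 2 ≤ q + 1 := by exact_mod_cast h3
  omega

/-- Under «every `≤ (q+1)`-subset of `E` is independent», a subset of `E` with at least `q + 1` elements has
rank at least `q + 1`. -/
lemma succ_le_eRk_of_small_indep {S : Set α} {q : ℕ} (hS : S ⊆ M.E)
    (hsmall : ∀ T ⊆ M.E, T.encard ≤ q + 1 → M.Indep T) (hcard : ((q + 1 : ℕ) : ℕ∞) ≤ S.encard) :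
    ((q + 1 : ℕ) : ℕ∞) ≤ M.eRk S := by
  obtain ⟨T, hTS, hT⟩ := exists_subset_encard_eq hcard
  have hind : M.Indep T := hsmall T (hTS.trans hS) (by rw [hT]; push_cast; exact le_rfl)
  have := hind.encard_le_eRk_of_subset hTS
  rwa [hT] at this

/-- Under «every `≤ (q+1)`-subset of `E` is independent», a subset of `E` of rank `q` has exactly `q`
elements. -/
lemma ncard_eq_of_eRk_eq_of_small_indep [M.Finite] {S : Set α} {q : ℕ} (hS : S ⊆ M.E)
    (hsmall : ∀ T ⊆ M.E, T.encard ≤ q + 1 → M.Indep T) (hq : M.eRk S = q) : S.ncard = q := by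
  have hSfin : S.Finite := M.set_finite S hS
  have h1 : (q : ℕ∞) ≤ S.encard := hq ▸ M.eRk_le_encard S
  have h2 : S.encard ≤ q := by
    by_contra h
    rw [not_le] at h
    have hk : ((q + 1 : ℕ) : ℕ∞) ≤ S.encard := by
      push_cast
      exact Order.add_one_le_of_lt h
    have h3 := succ_le_eRk_of_small_indep hS hsmall hk
    rw [hq] at h3
    have h4 : q + 1 ≤ q := by exact_mod_cast h3
    omega
  rw [← hSfin.cast_ncard_eq] at h1 h2
  exact le_antisymm (by exact_mod_cast h2) (by exact_mod_cast h1)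

/-- `|U(p,q)| ≤ C(|E|, q)` under «every `≤ (q+1)`-subset is independent»: `A ↦ E ∖ A` injects `U(p,q)` into
the `q`-subsets of `E`. -/
lemma ncard_U_le_choose_of_small_indep [M.Finite] {p q : ℕ}
    (hsmall : ∀ T ⊆ M.E, T.encard ≤ q + 1 → M.Indep T) :
    {A : Set α | A ⊆ M.E ∧ M.eRk A = (p : ℕ∞) ∧ M.eRk (M.E \ A) = (q : ℕ∞)}.ncard ≤
      M.E.ncard.choose q := by
  have hEfin : M.E.Finite := M.set_finite M.E
  rw [← ncard_powerset_ncard hEfin q]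
  refine ncard_le_ncard_of_injOn (fun A => M.E \ A) ?_ ?_
    (hEfin.finite_subsets.subset (fun t ht => ht.1))
  · rintro A ⟨-, -, hqA⟩
    exact ⟨sdiff_subset, ncard_eq_of_eRk_eq_of_small_indep sdiff_subset hsmall hqA⟩
  · rintro A ⟨hA, -, -⟩ A' ⟨hA', -, -⟩ hEq
    simp only at hEq
    rw [← sdiff_sdiff_cancel_left hA, hEq, sdiff_sdiff_cancel_left hA']

/-- `Σ_{q<u<p} C(|E|, u) ≤ |Y(p,q)|` under «every `≤ (q+1)`-subset is independent»: every subset of `E` with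
`q < |S| < p` has `q < r(S) < p`. -/
lemma sum_choose_le_ncard_Y_of_small_indep [M.Finite] {p q : ℕ}
    (hsmall : ∀ T ⊆ M.E, T.encard ≤ q + 1 → M.Indep T) :
    ∑ u ∈ Finset.Ioo q p, M.E.ncard.choose u ≤
      {A : Set α | A ⊆ M.E ∧ (q : ℕ∞) < M.eRk A ∧ M.eRk A < (p : ℕ∞)}.ncard := by
  classical
  have hEfin : M.E.Finite := M.set_finite M.E
  have hEcard : hEfin.toFinset.card = M.E.ncard := (ncard_eq_toFinset_card _ hEfin).symm
  set F : Finset (Finset α) :=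
    (Finset.Ioo q p).biUnion (fun u => hEfin.toFinset.powersetCard u) with hF
  have hFcard : F.card = ∑ u ∈ Finset.Ioo q p, M.E.ncard.choose u := by
    rw [hF, Finset.card_biUnion]
    · exact Finset.sum_congr rfl (fun u _ => by rw [Finset.card_powersetCard, hEcard])
    · intro u _ v _ huv
      change Disjoint _ _
      rw [Finset.disjoint_left]
      intro s hs hs'
      rw [Finset.mem_powersetCard] at hs hs'
      exact huv (hs.2.symm.trans hs'.2)
  have hYfin : {A : Set α | A ⊆ M.E ∧ (q : ℕ∞) < M.eRk A ∧ M.eRk A < (p : ℕ∞)}.Finite :=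
    hEfin.finite_subsets.subset (fun A hA => hA.1)
  have key : ((F : Set (Finset α))).ncard ≤
      {A : Set α | A ⊆ M.E ∧ (q : ℕ∞) < M.eRk A ∧ M.eRk A < (p : ℕ∞)}.ncard := by
    refine ncard_le_ncard_of_injOn (fun s => (s : Set α)) ?_ ?_ hYfin
    · intro s hs
      rw [Finset.mem_coe, hF, Finset.mem_biUnion] at hs
      obtain ⟨u, hu, hs⟩ := hs
      rw [Finset.mem_powersetCard] at hs
      rw [Finset.mem_Ioo] at hu
      have hsE : (s : Set α) ⊆ M.E := fun x hx => by
        have := hs.1 hx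
        rwa [hEfin.mem_toFinset] at this
      have hsenc : (s : Set α).encard = u := by rw [encard_coe_eq_coe_finsetCard, hs.2]
      refine ⟨hsE, ?_, ?_⟩
      · have h := succ_le_eRk_of_small_indep hsE hsmall (by rw [hsenc]; exact_mod_cast hu.1)
        exact lt_of_lt_of_le (by exact_mod_cast Nat.lt_succ_self q) h
      · calc M.eRk (s : Set α) ≤ (s : Set α).encard := M.eRk_le_encard _
          _ = u := hsenc
          _ < p := by exact_mod_cast hu.2
    · intro s _ s' _ hEq
      exact Finset.coe_injective hEq
  rw [ncard_coe_finset, hFcard] at key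
  exact key

/-- `C(n, u)/C(n, q) ≤ C(c, u)/C(c, q)` for `q ≤ u ≤ n ≤ c`, cross-multiplied (induction on `c` through
`Nat.choose_mul_succ_eq`): the ratio `C(c,u)/C(c,q) = Π_{i=q+1}^{u} (c−i+1)/i` is non-decreasing in `c`. -/
lemma choose_mul_choose_le_of_le {n q u : ℕ} (hqu : q ≤ u) (hun : u ≤ n) :
    ∀ c, n ≤ c → n.choose u * c.choose q ≤ c.choose u * n.choose q := by
  intro c hc
  induction c, hc using Nat.le_induction with
  | base => rw [mul_comm]
  | succ c hnc ih =>
    have hu' : (c + 1).choose u * (c + 1 - u) = c.choose u * (c + 1) :=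
      (Nat.choose_mul_succ_eq c u).symm
    have hq' : (c + 1).choose q * (c + 1 - q) = c.choose q * (c + 1) :=
      (Nat.choose_mul_succ_eq c q).symm
    have hpos : 0 < (c + 1 - u) * (c + 1 - q) :=
      Nat.mul_pos (by omega) (by omega)
    refine Nat.le_of_mul_le_mul_right ?_ hpos
    calc n.choose u * (c + 1).choose q * ((c + 1 - u) * (c + 1 - q))
        = n.choose u * ((c + 1).choose q * (c + 1 - q)) * (c + 1 - u) := by ring
      _ = n.choose u * (c.choose q * (c + 1)) * (c + 1 - u) := by rw [hq']
      _ = (n.choose u * c.choose q) * (c + 1) * (c + 1 - u) := by ring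
      _ ≤ (c.choose u * n.choose q) * (c + 1) * (c + 1 - q) :=
          Nat.mul_le_mul (Nat.mul_le_mul_right _ ih) (by omega)
      _ = n.choose q * ((c + 1).choose u * (c + 1 - u)) * (c + 1 - q) := by rw [hu']; ring
      _ = (c + 1).choose u * n.choose q * ((c + 1 - u) * (c + 1 - q)) := by ring

/-- **C-025, Theorem G′** (mine-2, MINE2-RLS.md §7): if every subset of `E` with at most `q + 1` elements is
independent (every circuit has `≥ q + 2` elements; for `q = 1`: `M` simple), then
`Φ(p,q)·#{A ⊆ E : r(A) = p, r(E ∖ A) = q} ≤ #{A ⊆ E : q < r(A) < p}` — the `C025` body — for all `p`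
(for `p ≤ q + 1` the left side is `0`). -/
theorem c025_of_small_indep [M.Finite] (p q : ℕ)
    (hsmall : ∀ T ⊆ M.E, T.encard ≤ q + 1 → M.Indep T) :
    phiK p q * ({A : Set α | A ⊆ M.E ∧ M.eRk A = (p : ℕ∞) ∧ M.eRk (M.E \ A) = (q : ℕ∞)}.ncard : ℚ) ≤
      ({A : Set α | A ⊆ M.E ∧ (q : ℕ∞) < M.eRk A ∧ M.eRk A < (p : ℕ∞)}.ncard : ℚ) := by
  by_cases hU : {A : Set α | A ⊆ M.E ∧ M.eRk A = (p : ℕ∞) ∧ M.eRk (M.E \ A) = (q : ℕ∞)} = ∅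
  · rw [hU, ncard_empty]
    simp
  obtain ⟨A, hA, hpA, hqA⟩ := nonempty_iff_ne_empty.2 hU
  have hEfin : M.E.Finite := M.set_finite M.E
  have hAfin : A.Finite := hEfin.subset hA
  have hcA : p ≤ A.ncard := by
    have h := hpA ▸ M.eRk_le_encard A
    rw [← hAfin.cast_ncard_eq] at h
    exact_mod_cast h
  have hcEA : (M.E \ A).ncard = q := ncard_eq_of_eRk_eq_of_small_indep sdiff_subset hsmall hqA
  have hc : p + q ≤ M.E.ncard := by
    have := ncard_sdiff_add_ncard_of_subset hA hEfin
    omega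
  have hUle := ncard_U_le_choose_of_small_indep (M := M) (p := p) hsmall
  have hYge := sum_choose_le_ncard_Y_of_small_indep (M := M) (p := p) hsmall
  have hbin : (∑ u ∈ Finset.Ioo q p, (p + q).choose u) * M.E.ncard.choose q ≤
      (∑ u ∈ Finset.Ioo q p, M.E.ncard.choose u) * (p + q).choose q := by
    rw [Finset.sum_mul, Finset.sum_mul]
    refine Finset.sum_le_sum (fun u hu => ?_)
    rw [Finset.mem_Ioo] at hu
    exact choose_mul_choose_le_of_le (by omega) (by omega) _ hc
  have hchoose : (0 : ℚ) < ((p + q).choose p : ℚ) := by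
    exact_mod_cast Nat.choose_pos (by omega)
  have hsymm : (p + q).choose p = (p + q).choose q := Nat.choose_symm_add
  have hphi : phiK p q * (M.E.ncard.choose q : ℚ) ≤
      ∑ u ∈ Finset.Ioo q p, (M.E.ncard.choose u : ℚ) := by
    unfold phiK
    rw [div_mul_eq_mul_div, div_le_iff₀ hchoose, hsymm]
    exact_mod_cast hbin
  have hphi_nonneg : 0 ≤ phiK p q := by
    unfold phiK
    positivity
  calc phiK p q * ({A : Set α | A ⊆ M.E ∧ M.eRk A = (p : ℕ∞) ∧ M.eRk (M.E \ A) = (q : ℕ∞)}.ncard : ℚ)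
      ≤ phiK p q * (M.E.ncard.choose q : ℚ) :=
        mul_le_mul_of_nonneg_left (by exact_mod_cast hUle) hphi_nonneg
    _ ≤ ∑ u ∈ Finset.Ioo q p, (M.E.ncard.choose u : ℚ) := hphi
    _ = ((∑ u ∈ Finset.Ioo q p, M.E.ncard.choose u : ℕ) : ℚ) := by push_cast; rfl
    _ ≤ ({A : Set α | A ⊆ M.E ∧ (q : ℕ∞) < M.eRk A ∧ M.eRk A < (p : ℕ∞)}.ncard : ℚ) := by
        exact_mod_cast hYge

/-- **Theorem G′ in circuit form**: if every circuit of `M` has at least `q + 2` elements then the `C025`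
body holds for `(p, q)`, every `p`. -/
theorem c025_of_circuits [M.Finite] (p q : ℕ)
    (hcirc : ∀ C, M.IsCircuit C → ((q + 2 : ℕ) : ℕ∞) ≤ C.encard) :
    phiK p q * ({A : Set α | A ⊆ M.E ∧ M.eRk A = (p : ℕ∞) ∧ M.eRk (M.E \ A) = (q : ℕ∞)}.ncard : ℚ) ≤
      ({A : Set α | A ⊆ M.E ∧ (q : ℕ∞) < M.eRk A ∧ M.eRk A < (p : ℕ∞)}.ncard : ℚ) :=
  c025_of_small_indep p q (small_indep_of_circuits hcirc)

end PercRepro
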